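import Mathlib
import Summits.Ventures.PercRepro2.Defs
import Summits.Ventures.PercRepro2.Graph
import Summits.Ventures.PercRepro2.OneColourSwitch
import Summits.Ventures.PercRepro2.RegionHubSign
import Summits.Ventures.PercRepro2.SideSwitch
import Summits.Ventures.PercRepro2.SideSwitchM9
import Summits.Ventures.PercRepro2.M9NoPocketDefs
import Summits.Ventures.PercRepro2.M9NoPocketM9
import Summits.Ventures.PercRepro2.M9ConjG

/-!
# A class theorem from Conjecture G: non-marks adjacent to `p` or `q`, or pendant, besides a
vertex `d` adjacent to `r` and `s` (blind cell PercRepro2, p3 g24, 2026-08-28)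

If every non-mark other than `d` is adjacent to `p` or to `q`, or is pendant (a single edge),
then no `Sep`-colouring reaches such a vertex in both colours (`DOne_of_adj_or_pendant`), so the
`m9` sign sum is the single-`d` sum and Conjecture G gives `m9 ≤ 0` whenever `d` is adjacent to
`r` and to `s` (`m9SignSum_nonpos_of_adj_or_pendant_d`).  Own work; std axioms.
-/

namespace Summit.Ventures.PercRepro2

namespace NoPocket

open Finset Classical RegionHub OneColourSwitch SideSwitch

variable {V : Type*} {E : Type*}

section Class

variable {ends : E → Sym2 V}

/-- `DOne` holds for every `Sep`-colouring when every non-mark other than `d` is adjacent to `p`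
or `q`, or pendant. -/
lemma DOne_of_adj_or_pendant {p q r s d : V}
    (hadj : ∀ x, Nonmark p q r s x → x ≠ d →
      (∃ e, ends e = s(x, p) ∨ ends e = s(x, q)) ∨ ∃ e₁, Pendant ends x e₁)
    {ω : Config E} (h : sep2 ends p q r s ω) : DOne ends r s d ω := by
  intro x hr hs hd hK hM
  rcases hadj x (nonmark_of_mem_U2 h (Or.inl hK) hr hs) hd with ⟨e, he⟩ | ⟨e₁, hp⟩
  · obtain ⟨⟨hpK, hqK⟩, ⟨hpM, hqM⟩⟩ := sep2_iff.1 h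
    cases hc : ω e
    · rcases he with he | he
      · exact hpM (mem_M2_of_closed hM hc he)
      · exact hqM (mem_M2_of_closed hM hc he)
    · rcases he with he | he
      · exact hpK (mem_K2_of_open hK hc he)
      · exact hqK (mem_K2_of_open hK hc he)
  · exact not_mem_both_of_pendant hp hr hs hK hM

end Class

section Main

variable [Fintype V] [DecidableEq V] [Fintype E] [DecidableEq E] {ends : E → Sym2 V}

/-- **`m9 ≤ 0` on the class «every non-mark other than `d` is adjacent to `p` or `q`, or
pendant; `d` adjacent to `r` and `s`».** -/
theorem m9SignSum_nonpos_of_adj_or_pendant_d {p q r s d : V}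
    (hadj : ∀ x, Nonmark p q r s x → x ≠ d →
      (∃ e, ends e = s(x, p) ∨ ends e = s(x, q)) ∨ ∃ e₁, Pendant ends x e₁)
    (hpd : p ≠ d) (hqd : q ≠ d) (hr : d ≠ r) (hs : d ≠ s) {er es : E} (her : ends er = s(d, r))
    (hes : ends es = s(d, s)) : m9SignSum ends p q r s ≤ 0 :=
  m9SignSum_nonpos_of_dOne (fun _ hsep => DOne_of_adj_or_pendant hadj hsep) hr hs hpd hqd her hes

end Main

end NoPocket

end Summit.Ventures.PercRepro2
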